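import Summits.QuantumFields.BalabanUV.Beta.GAN24.T2RecSourceRowsSlot
import Summits.QuantumFields.BalabanUV.Beta.GAN24.KSlotCombChart
import Summits.QuantumFields.BalabanUV.Beta.GAN24.CombSpureRowsOfSRows
import Summits.QuantumFields.BalabanUV.Beta.GAN24.CombWrecEvenHalfRows

/-!
# `BalabanUV.Beta.GAN24.CombT2RecSourceRows` — binder row G-an2-4 ∕ (CONV-C), TRANSFER-III (the (α-0) chain at row D1's literal of record (III′)), THE SOURCE-ROW SOCKET:
# **THE DRESSED COMB-CHART SOURCE `b̃′♮` AT an1's RECORD IS `j`-UNIFORMLY `LocStencil₂` AND CAUCHY AT A GEOMETRIC RATE, FROM THE S-SLOT ROWS (hS, hSall) OF `ScombOf` ALONE — the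
# binders `Hb ∕ Hbd` of leaf-03 g81's W4 `CombLegRowsOfNaturalWindows` (lines 168–171), of MY F1∕F4 `CombSlavedDivRows{OfWardLetters,AtRecord}` and of MY F5–F9 twins, in THEIR
# spelling, as ONE theorem** (the OWNER gan24-p1 g48's W-4 l.67070 «so that road-P2's future (III′) source-row socket discharges W4, your F1∕F4 and these two twins with ONE lemma»):
# MY generic-slot sockets `T2RecSourceRowsSlot.source_shape_of_rows_slot ∕ source_cauchy_of_rows_slot` at `K := GcombSh Lc` (leaf-02 g77's (III′) K-slot `kSlotCombSh_holds`, BOTH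
# rows), `S := SpureCombOf (symTablesAn1S2 3 Lc cΛt) cE cVH cΛ` (leaf-02 g79's «S′ from S»), `M := (symTablesAn1S2 3 Lc cΛt).M` (`j`-free unit table `cΛt • symHessFFAt ρ_c Lc` by
# leaf-02's `CombWrecEvenHalfRows.unitM_M1Of_eq_of_ff`, a vertex family at every rate by an2's `vertexFamily_smul_symHessFFAt`), the record's mixed ∕ border letters
# (`symMixFFAt_inl_inr ∕ _inr`, `.hmix`, `.hB`) — the (III′) twin of p2 g35's `T2RecSourceRows.source_rows_three_of_srecAt_rows` (G-an2-4 CRUX TEAM (2), leaf prover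
# `b2b-balaban-gan24-formalise-leaf-01`, gen 82; road-P2 seatless after g56 — its socket typed in order by the kept leaf prover; no existing file touched)

NOT IN PRINT; OUR BOOKKEEPING ([folklore] composition BY NAME; 0 `def`, 0 cited facts, 0 `def … : Prop`, 0 sorry).  HONEST FRAMING (cell contract, verbatim): «discharging
`BetaPertH` makes Bałaban's UV stability UNCONDITIONAL — a real constructive-QFT result; it is NOT the continuum limit and NOT the Clay problem.»  HONEST DEPENDENCY (verbatim):
«continuum YM on T⁴ ⇐ BetaPertH ∧ nine spine estimates (0/9 proved); BetaPertH ⇐ (D1) ∧ (D4) ∧ CAP+tail; G-an2-4 gates asym, D1 and NE2/3/4.»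

WHAT (`d = 3`, `2 ≤ Lc`, an1's record `symTablesAn1S2 3 Lc cΛt`, every `cE cVH cΛ cE₂ cB`): **`exists_sourceRows_comb_three_an1_of_scombOf_rows`** — `∃ Cb δb cb θb, 0 < δb ∧ 0 ≤ cb ∧ 0 ≤ θb
∧ θb < 1 ∧ (∀ n, LocStencil₂ (b̃′♮_n) Cb δb) ∧ (∀ l, LocStencil₂ (b̃′♮_{l+1} − b̃′♮_l) (cb·θb^l) δb)` ⟸ the S-slot rows (hS, hSall) of `unitS_j (ScombOf (symTablesAn1S2 3 Lc cΛt) cE cVH cΛ j)`.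
WHAT THIS IS NOT.  (hS, hSall) are the S′-campaign's (road-P2 g56's M.104 reduces them to six contact letters) — DISPLAYED; asserts NO value of any charge; NOT one W-slot row; the (III′)
campaign is NOT asked (an2 W-4 l.64553); NEVER «G-an2-4 closed» as (CONV-C); NOT D1, NOT `BetaPertH`, NOT continuum, NOT Clay; not in print.  2026-08-25.
-/

noncomputable section

open Finset
open scoped BigOperators
open Literature.MathematicalPhysics.QuantumFieldTheory
open Literature.MathematicalPhysics.QuantumFieldTheory.Balaban1983to89
open Literature.MathematicalPhysics.QuantumFieldTheory.Balaban1983to89.Beta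
open ExpKernelCalculus (MKer Decays VertexFamily)
open OneStepResolventKernel (Fib LocStencil)
open AffineAveraging (box toSite)
open AveragingContoursRooted (ctr ctrOff ctrOff_mem_box)
open AveragingHessianKernels (ell)
open BalabanStepJetsSucc (mmRead)
open BalabanCompositeJets (LocStencil₂ LocStencil₂.mono)
open SecondOrderResponse (W2SymOfK)
open BalabanStepW2 (M2Of K3OfK)
open Summit.QuantumFields.BalabanUV.Beta.HessKerDressedUnits (unitK unitS)
open Summit.QuantumFields.BalabanUV.Beta.SecondOrderUnits (unitM unitS₂ unitM₂)
open Summit.QuantumFields.BalabanUV.Beta.AxialDressingRooted (one_le_of_neZero)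
open Summit.QuantumFields.BalabanUV.Beta.SymAveragingHessianCounts (symHessFFAt symHessFFAt_inl_inr symHessFFAt_inr vertexFamily_smul_symHessFFAt)
open Summit.QuantumFields.BalabanUV.Beta.SymAveragingMixedJetTables (symMixFFAt symMixFFAt_inl_inr symMixFFAt_inr)
open Summit.QuantumFields.BalabanUV.Beta.CombChartStepJets (GcombSh ScombOf SpureCombOf)
open Summit.QuantumFields.BalabanUV.Beta.SymSecondOrderTablesAn1 (symTablesAn1S2 symTablesAn1S2_M symTablesAn1S2_mixFF)
open Summit.QuantumFields.BalabanUV.Beta.GAN24.CombesThomas (sfStep smStep)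
open Summit.QuantumFields.BalabanUV.Beta.GAN24.KSlotCombChart (kSlotCombSh_holds)
open Summit.QuantumFields.BalabanUV.Beta.GAN24.CombSpureRowsOfSRows (exists_spureCombOf_rows_three_of_scombOf_rows)
open Summit.QuantumFields.BalabanUV.Beta.GAN24.CombWrecEvenHalfRows (unitM_M1Of_eq_of_ff)
open Summit.QuantumFields.BalabanUV.Beta.GAN24.T2RecSourceRowsSlot (source_shape_of_rows_slot source_cauchy_of_rows_slot)

namespace Summit.QuantumFields.BalabanUV.Beta.GAN24.CombT2RecSourceRows

variable {Lc : ℕ} [NeZero Lc]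

/-- NOT IN PRINT; OUR BOOKKEEPING.  **THE SOURCE ROWS `Hb ∕ Hbd` AT an1's RECORD FROM THE S-SLOT ROWS OF `ScombOf` ALONE** (`d = 3`, `2 ≤ Lc`; W4's ∕ F1's ∕ F4–F9's spelling, ONE
common rate): MY `T2RecSourceRowsSlot` sockets at the comb-chart kernels (leaf-02's K-slot, both rows), «S′ from S» (leaf-02), the record's `j`-free unit multiplier
(`unitM_M1Of_eq_of_ff` ⨾ `vertexFamily_smul_symHessFFAt` at the centred root), its mixed ∕ border letters.  The (III′) twin of p2 g35's `source_rows_three_of_srecAt_rows`. -/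
theorem exists_sourceRows_comb_three_an1_of_scombOf_rows (hLc : 2 ≤ Lc) (cΛt cE cVH cΛ cE₂ cB : ℝ) {Cs cS θS δS : ℝ}
    (hS : ∀ j, LocStencil (unitS (sfStep Lc j) (smStep 3 Lc j) (ScombOf (symTablesAn1S2 3 Lc cΛt) cE cVH cΛ j)) Cs δS)
    (hSall : ∀ k j, LocStencil (unitS (sfStep Lc (k + j)) (smStep 3 Lc (k + j)) (ScombOf (symTablesAn1S2 3 Lc cΛt) cE cVH cΛ (k + j)) -
      unitS (sfStep Lc k) (smStep 3 Lc k) (ScombOf (symTablesAn1S2 3 Lc cΛt) cE cVH cΛ k)) (cS * θS ^ k) δS)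
    (hδS : 0 < δS) (hθS0 : 0 ≤ θS) (hθS1 : θS < 1) :
    ∃ Cb δb cb θb : ℝ, 0 < δb ∧ 0 ≤ cb ∧ 0 ≤ θb ∧ θb < 1 ∧
      (∀ n : ℕ, LocStencil₂ (fun κ u κ' u' => (cE₂ * (Lc : ℝ) ^ (2 * (3 + 1))) • mmRead Lc (K3OfK (unitK (sfStep Lc n) (smStep 3 Lc n) (GcombSh (d := 3) Lc n)) Lc (unitS (sfStep Lc n) (smStep 3 Lc n) (SpureCombOf (symTablesAn1S2 3 Lc cΛt) cE cVH cΛ n)) (unitM (sfStep Lc n) (smStep 3 Lc n) ((symTablesAn1S2 3 Lc cΛt).M n)) (W2SymOfK (unitK (sfStep Lc n) (smStep 3 Lc n) (GcombSh (d := 3) Lc n)) Lc (unitS (sfStep Lc n) (smStep 3 Lc n) (SpureCombOf (symTablesAn1S2 3 Lc cΛt) cE cVH cΛ n)) (unitM (sfStep Lc n) (smStep 3 Lc n) ((symTablesAn1S2 3 Lc cΛt).M n)) 0 (unitM₂ (sfStep Lc n) (smStep 3 Lc n) (M2Of 3 Lc (symTablesAn1S2 3 Lc cΛt).mixFF n)))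 κ u κ' u') + cB • (symTablesAn1S2 3 Lc cΛt).vh₂S κ u κ' u') Cb δb) ∧
      (∀ l : ℕ, LocStencil₂ ((fun κ u κ' u' => (cE₂ * (Lc : ℝ) ^ (2 * (3 + 1))) • mmRead Lc (K3OfK (unitK (sfStep Lc (l + 1)) (smStep 3 Lc (l + 1)) (GcombSh (d := 3) Lc (l + 1))) Lc (unitS (sfStep Lc (l + 1)) (smStep 3 Lc (l + 1)) (SpureCombOf (symTablesAn1S2 3 Lc cΛt) cE cVH cΛ (l + 1))) (unitM (sfStep Lc (l + 1)) (smStep 3 Lc (l + 1)) ((symTablesAn1S2 3 Lc cΛt).M (l + 1))) (W2SymOfK (unitK (sfStep Lc (l + 1)) (smStep 3 Lc (l + 1)) (GcombSh (d := 3) Lc (l + 1))) Lc (unitS (sfStep Lc (l + 1)) (smStep 3 Lc (l + 1)) (SpureCombOf (symTablesAn1S2 3 Lc cΛt) cE cVH cΛ (l + 1))) (unitM (sfStep Lc (l + 1)) (smStep 3 Lc (l + 1)) ((symTablesAn1S2 3 Lc cΛt).M (l + 1))) 0 (unitM₂ (sfStep Lc (l + 1)) (smStep 3 Lc (l + 1))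 (M2Of 3 Lc (symTablesAn1S2 3 Lc cΛt).mixFF (l + 1)))) κ u κ' u') + cB • (symTablesAn1S2 3 Lc cΛt).vh₂S κ u κ' u')
        - (fun κ u κ' u' => (cE₂ * (Lc : ℝ) ^ (2 * (3 + 1))) • mmRead Lc (K3OfK (unitK (sfStep Lc l) (smStep 3 Lc l) (GcombSh (d := 3) Lc l)) Lc (unitS (sfStep Lc l) (smStep 3 Lc l) (SpureCombOf (symTablesAn1S2 3 Lc cΛt) cE cVH cΛ l)) (unitM (sfStep Lc l) (smStep 3 Lc l) ((symTablesAn1S2 3 Lc cΛt).M l)) (W2SymOfK (unitK (sfStep Lc l) (smStep 3 Lc l) (GcombSh (d := 3) Lc l)) Lc (unitS (sfStep Lc l) (smStep 3 Lc l) (SpureCombOf (symTablesAn1S2 3 Lc cΛt) cE cVH cΛ l)) (unitM (sfStep Lc l) (smStep 3 Lc l) ((symTablesAn1S2 3 Lc cΛt).M l)) 0 (unitM₂ (sfStep Lc l) (smStep 3 Lc l) (M2Of 3 Lc (symTablesAn1S2 3 Lc cΛt).mixFF l))) κ u κ' u') + cB • (symTablesAn1S2 3 Lc cΛt).vh₂S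 κ u κ' u')) (cb * θb ^ l) δb) := by
  have hLc1 : 1 ≤ Lc := by omega
  obtain ⟨C, δK, cK, θK, hδK, hθK0, hθK1, hG, hGall⟩ := kSlotCombSh_holds (Lc := Lc) hLc
  obtain ⟨Cs', cS', θ', δ', hθ'0, hθ'1, hδ', hS', hSall'⟩ := exists_spureCombOf_rows_three_of_scombOf_rows hLc cΛt cE cVH cΛ hS hSall hδS hθS0 hθS1
  obtain ⟨CM₂, δ₄, hδ₄, hmix⟩ := (symTablesAn1S2 3 Lc cΛt).hmix
  obtain ⟨CB, δB, hδB, hB⟩ := (symTablesAn1S2 3 Lc cΛt).hB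
  -- the record's multiplier slot: `j`-free unit table, a vertex family at every rate (centred root)
  have hMu : ∀ j, unitM (sfStep Lc j) (smStep 3 Lc j) ((symTablesAn1S2 3 Lc cΛt).M j) = fun μ w => cΛt • symHessFFAt (ctr (3 + 1) Lc) Lc μ w := by
    intro j
    rw [symTablesAn1S2_M]
    exact unitM_M1Of_eq_of_ff _ (fun μ w x z α μ' => symHessFFAt_inl_inr _ _ μ w x z α μ') (fun μ w x z μ' b => symHessFFAt_inr _ _ μ w x z μ' b) cΛt j
  have hCMu : ∀ δ : ℝ, 0 ≤ δ → VertexFamily (fun μ w => cΛt • symHessFFAt (ctr (3 + 1) Lc) Lc μ w) Lc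
      (|cΛt| * (2 * (ell (3 + 1) Lc : ℝ) ^ 2 * Real.exp (4 * (((3 : ℕ) : ℝ) + 1) * Lc * δ))) δ :=
    fun δ hδ => vertexFamily_smul_symHessFFAt hLc1 (ctrOff_mem_box hLc1) cΛt hδ
  have hfm : ∀ κ u ρ' w x z (α μ' : Fin (3 + 1)), (symTablesAn1S2 3 Lc cΛt).mixFF κ u ρ' w x z (Sum.inl α) (Sum.inr μ') = 0 :=
    fun κ u ρ' w x z α μ' => symMixFFAt_inl_inr (ctr (3 + 1) Lc) Lc κ u ρ' w x z α μ'
  have hm : ∀ κ u ρ' w x z (μ' : Fin (3 + 1)) (b : Fib 3), (symTablesAn1S2 3 Lc cΛt).mixFF κ u ρ' w x z (Sum.inr μ') b = 0 :=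
    fun κ u ρ' w x z μ' b => symMixFFAt_inr (ctr (3 + 1) Lc) Lc κ u ρ' w x z μ' b
  obtain ⟨Cb, δb, hδb, hb⟩ := source_shape_of_rows_slot (d := 3) hLc1 hMu hCMu hG hδK hS' hδ' hmix hδ₄ hfm hm hB hδB cE₂ cB
  obtain ⟨cb, θb, δb', hcb, hθb0, hθb1, hδb', hbd⟩ := source_cauchy_of_rows_slot (d := 3) hLc1 hMu hCMu hG hGall hδK hθK0 hθK1 hS' hSall' hδ' hθ'0 hθ'1
    hmix hδ₄ hfm hm (symTablesAn1S2 3 Lc cΛt).vh₂S cE₂ cB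
  refine ⟨Cb, min δb δb', cb, θb, lt_min hδb hδb', hcb, hθb0, hθb1, fun n => (hb n).mono (min_le_left _ _), fun l => ?_⟩
  exact (hbd l 1).mono (min_le_right _ _)

end Summit.QuantumFields.BalabanUV.Beta.GAN24.CombT2RecSourceRows

end
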